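import Summits.NavierStokesRegularity.NavierStokesRegularity.Theorems.CriticalSwirlRegularity.Negative.HardnessSandwich

/-!
# Route FlatSwirlGauge — status of the three registered stubs of the dead line `registered`

Negative-side (dossier) support file for the crux `CriticalSwirlRegularity` (CSR, item
`stmt-NavierStokesRegularity-1253`, route `FlatSwirlGauge` of NavierStokesRegularity), written by the line lead
(continuation c5) of the line `registered` (birth skeleton `Cruxes/CriticalSwirlRegularity/Lines/birth.lean`,
sha `690709cf…`, stubs S1 `stub_axislikeGaugeAtSingularity`, S2 `stub_momentumUniformContinuity`,
S3 `stub_continuousMomentumRegularity`). It completes the hardness sandwich of c4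
(`HardnessSandwich.lean`: `NoBlowup ⟹ CSR ⟹ localized axisymmetric swirl-dominated regularity`) at the level
of the individual STUBS, replacing the prose of the dossiers `Lines/registered-dead*.md` by checked implications:

* S2 is false as registered (`stub_momentumUniformContinuity_false`, c1) and so is its Dirichlet repair
  (`dirichlet_stub_momentumUniformContinuity_false`, c3) — recorded in the sibling files, not repeated.
* `stub_axislikeGaugeAtSingularity_of_noBlowup`, `stub_continuousMomentumRegularity_of_noBlowup`: S1 and S3
  each follow from the no-blow-up statement for classical Leray–Hopf solutions from rapidly decaying data
  (verbatim the hypothesis of the route's support `NoBlowupToClay`). Hence `¬ S1` or `¬ S3` would be a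
  finite-time blow-up: neither stub is refutable by a rest-state / smooth-background witness, and no refuter
  seat can settle them short of the negative answer to the regularity problem.
* `stub_axislikeGaugeAtSingularity_of_criticalSwirlRegularity`,
  `stub_continuousMomentumRegularity_of_criticalSwirlRegularity`: S1 and S3 follow from the crux itself (for S3
  the local thinness clause specialises to the typed one at `y = x₀`, `s = ρ`). So once S2 is false the
  skeleton `S1 ∧ S2 ∧ S3 ⟹ CSR` carries no information beyond CSR.
* `bounded_of_stub_continuousMomentumRegularity_of_axisymmetric`: S3 ALONE implies LOCALIZED REGULARITY OF
  AXISYMMETRIC FLOWS IN THE SWIRL-DOMINATED REGIME UNDER A BARE UNIFORM MODULUS OF THE SWIRL — for a classical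
  Leray–Hopf solution on `[0, T)` from a rapidly decaying datum with axisymmetric velocity and pressure, if on
  `Q_ρ(T, x₀)` the swirl `Γ = r u_θ` satisfies `|Γ| ≤ M`, `‖ω‖ r ≤ C ‖∇Γ‖` and is uniformly continuous in
  `(t, x)` up to `T`, then `u` is bounded near `(T, x₀)`. Print reaches such a conclusion only with a RATE at the
  axis — `|Γ| ≤ C₁|ln r|⁻²` (Lei–Zhang 2017, Cor. 1.3), `|ln r|^{-3/2}` (Wei 2016, Cor. 1.1), Hölder continuity
  (Chen–Fang–Zhang 2017), or smallness relative to an `r₀`-dependent threshold `δ M₁(r₀)⁻¹` (Lei–Zhang 2017,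
  Thm. 1.4) — and globally along the axis, not localized; a bare modulus is open even there. So the last stub of
  the line is itself beyond print, independently of S2.

Nothing here is new mathematics; the only analysis is c4's `bounded_near_of_hasSmoothExtensionPast` and the
in-tree exactly-flat anchor `IsClassicalNSSolutionOn.isFlatSwirlGaugeOn_swirl` (KNSS 2009, eq. (1.8)) with the
tube estimate `volume_cylRadius_lt_inter_ball_le` applied on sub-balls.

## References

* G. Koch, N. Nadirashvili, G. Seregin, V. Šverák, *Liouville theorems for the Navier–Stokes equations and
  applications*, Acta Math. 203 (2009) 83–105, eq. (1.8). [KNSS2009]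
* Z. Lei, Q. S. Zhang, *Criticality of the axially symmetric Navier–Stokes equations*, Pacific J. Math. 289
  (2017) 169–187, Thm. 1.2, Cor. 1.3, Thm. 1.4. [LeiZhang2017]
* D. Wei, *Regularity criterion to the axially symmetric Navier–Stokes equations*, J. Math. Anal. Appl. 435
  (2016) 402–413, Cor. 1.1. [Wei2016]
-/

namespace Summit.NavierStokesRegularity.NavierStokesRegularity.Theorems.CriticalSwirlRegularity.Negative

open Literature.Analysis.FluidPDE Set Metric

/-- **No blow-up implies stub S1 (`stub_axislikeGaugeAtSingularity`).** Under the no-blow-up statement for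
classical Leray–Hopf solutions from rapidly decaying data (verbatim the hypothesis of the route's support
`NoBlowupToClay`), the registered signature of S1 holds — vacuously: its hypothesis "`u` is unbounded on every
backward cylinder at `(T, x₀)`" contradicts `bounded_near_of_hasSmoothExtensionPast`. Consequently `¬ S1` is a
finite-time blow-up from a rapidly decaying datum: S1 is irrefutable by any explicit smooth witness. [folklore] -/
theorem stub_axislikeGaugeAtSingularity_of_noBlowup
    (hNB : ∀ (ν T : ℝ), 0 < ν → 0 < T →
      ∀ (u : ℝ → EuclideanSpace ℝ (Fin 3) → EuclideanSpace ℝ (Fin 3))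
        (p : ℝ → EuclideanSpace ℝ (Fin 3) → ℝ),
        IsClassicalNSSolutionOn (Set.Ico 0 T) ν 0 u p → IsLerayHopfOn T ν 0 (u 0) u →
          HasRapidSpatialDecay (u 0) → HasSmoothExtensionPast ν 0 u T) :
    ∀ (ν T : ℝ), 0 < ν → 0 < T →
      ∀ (u : ℝ → EuclideanSpace ℝ (Fin 3) → EuclideanSpace ℝ (Fin 3)) (p : ℝ → EuclideanSpace ℝ (Fin 3) → ℝ),
        Literature.Analysis.FluidPDE.IsClassicalNSSolutionOn (Set.Ico 0 T) ν 0 u p →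
        Literature.Analysis.FluidPDE.IsLerayHopfOn T ν 0 (u 0) u →
        Literature.Analysis.FluidPDE.HasRapidSpatialDecay (u 0) →
      ∀ (x₀ : EuclideanSpace ℝ (Fin 3)) (ρ C₀ M : ℝ) (α : ℝ → EuclideanSpace ℝ (Fin 3) → ℝ)
        (b : ℝ → EuclideanSpace ℝ (Fin 3) → EuclideanSpace ℝ (Fin 3)) (d : ℝ → EuclideanSpace ℝ (Fin 3) → ℝ),
        (0 < ρ ∧ ρ ^ 2 < T ∧ ContDiffOn ℝ 2 (Function.uncurry α) (Set.Ioo (T - ρ ^ 2) T ×ˢ Metric.ball x₀ ρ) ∧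
          (∀ t ∈ Set.Ioo (T - ρ ^ 2) T, ∀ δ ∈ Set.Ioo 0 ρ,
            MeasureTheory.volume ({x | d t x < δ} ∩ Metric.ball x₀ ρ) ≤ ENNReal.ofReal (C₀ * δ ^ 2 * ρ)) ∧
          (∀ t ∈ Set.Ioo (T - ρ ^ 2) T, ∀ x ∈ Metric.ball x₀ ρ, |α t x| ≤ M ∧
            inner ℝ (Literature.Analysis.FluidPDE.curl (u t) x) (gradient (α t) x) = 0 ∧
            (0 < d t x → ‖Literature.Analysis.FluidPDE.curl (u t) x‖ * d t x ≤ C₀ * ‖gradient (α t) x‖ ∧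
              ‖b t x‖ * d t x ≤ C₀ ∧
              deriv (fun s => α s x) t + Literature.Analysis.FluidPDE.convect (u t) (α t) x =
                ν * (Laplacian.laplacian (α t) x + inner ℝ (b t x) (gradient (α t) x))))) →
        ¬ (∃ r : ℝ, 0 < r ∧ ∃ K : ℝ, ∀ t ∈ Set.Ioo (T - r ^ 2) T, 0 ≤ t →
            ∀ x ∈ Metric.ball x₀ r, ‖u t x‖ ≤ K) →
        ∃ (ρ₁ C₁ M₁ : ℝ) (b₁ : ℝ → EuclideanSpace ℝ (Fin 3) → EuclideanSpace ℝ (Fin 3))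
          (d₁ : ℝ → EuclideanSpace ℝ (Fin 3) → ℝ),
          0 < ρ₁ ∧ ρ₁ ^ 2 < T ∧
          ContDiffOn ℝ 2 (Function.uncurry α) (Set.Ioo (T - ρ₁ ^ 2) T ×ˢ Metric.ball x₀ ρ₁) ∧
          (∀ t ∈ Set.Ioo (T - ρ₁ ^ 2) T, ∀ (y : EuclideanSpace ℝ (Fin 3)) (s : ℝ), 0 < s →
            Metric.ball y s ⊆ Metric.ball x₀ ρ₁ →
            ∀ δ ∈ Set.Ioo 0 s, MeasureTheory.volume ({x | d₁ t x < δ} ∩ Metric.ball y s) ≤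
              ENNReal.ofReal (C₁ * δ ^ 2 * s)) ∧
          (∀ t ∈ Set.Ioo (T - ρ₁ ^ 2) T, ∀ x ∈ Metric.ball x₀ ρ₁, |α t x| ≤ M₁ ∧
            inner ℝ (Literature.Analysis.FluidPDE.curl (u t) x) (gradient (α t) x) = 0 ∧
            (0 < d₁ t x → ‖Literature.Analysis.FluidPDE.curl (u t) x‖ * d₁ t x ≤ C₁ * ‖gradient (α t) x‖ ∧
              ‖b₁ t x‖ * d₁ t x ≤ C₁ ∧
              deriv (fun s => α s x) t + Literature.Analysis.FluidPDE.convect (u t) (α t) x =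
                ν * (Laplacian.laplacian (α t) x + inner ℝ (b₁ t x) (gradient (α t) x)))) := by
  intro ν T hν hT u p hcl hLH hdec x₀ ρ C₀ M α b d _hG hunb
  exact absurd (bounded_near_of_hasSmoothExtensionPast (hNB ν T hν hT u p hcl hLH hdec) x₀) hunb

/-- **No blow-up implies stub S3 (`stub_continuousMomentumRegularity`).** Under the same no-blow-up statement
the registered signature of S3 holds, its gauge and modulus hypotheses unused: the conclusion of S3 is local
boundedness of `u` near `(T, x₀)`, which `bounded_near_of_hasSmoothExtensionPast` gives outright. Consequently
`¬ S3` is a finite-time blow-up from a rapidly decaying datum: S3 is irrefutable by any explicit smooth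
witness. [folklore] -/
theorem stub_continuousMomentumRegularity_of_noBlowup
    (hNB : ∀ (ν T : ℝ), 0 < ν → 0 < T →
      ∀ (u : ℝ → EuclideanSpace ℝ (Fin 3) → EuclideanSpace ℝ (Fin 3))
        (p : ℝ → EuclideanSpace ℝ (Fin 3) → ℝ),
        IsClassicalNSSolutionOn (Set.Ico 0 T) ν 0 u p → IsLerayHopfOn T ν 0 (u 0) u →
          HasRapidSpatialDecay (u 0) → HasSmoothExtensionPast ν 0 u T) :
    ∀ (ν T : ℝ), 0 < ν → 0 < T →
      ∀ (u : ℝ → EuclideanSpace ℝ (Fin 3) → EuclideanSpace ℝ (Fin 3)) (p : ℝ → EuclideanSpace ℝ (Fin 3) → ℝ),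
        Literature.Analysis.FluidPDE.IsClassicalNSSolutionOn (Set.Ico 0 T) ν 0 u p →
        Literature.Analysis.FluidPDE.IsLerayHopfOn T ν 0 (u 0) u →
        Literature.Analysis.FluidPDE.HasRapidSpatialDecay (u 0) →
      ∀ (x₀ : EuclideanSpace ℝ (Fin 3)) (ρ C₀ M : ℝ) (α : ℝ → EuclideanSpace ℝ (Fin 3) → ℝ)
        (b : ℝ → EuclideanSpace ℝ (Fin 3) → EuclideanSpace ℝ (Fin 3)) (d : ℝ → EuclideanSpace ℝ (Fin 3) → ℝ),
        (0 < ρ ∧ ρ ^ 2 < T ∧ ContDiffOn ℝ 2 (Function.uncurry α) (Set.Ioo (T - ρ ^ 2) T ×ˢ Metric.ball x₀ ρ) ∧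
          (∀ t ∈ Set.Ioo (T - ρ ^ 2) T, ∀ (y : EuclideanSpace ℝ (Fin 3)) (s : ℝ), 0 < s →
            Metric.ball y s ⊆ Metric.ball x₀ ρ →
            ∀ δ ∈ Set.Ioo 0 s, MeasureTheory.volume ({x | d t x < δ} ∩ Metric.ball y s) ≤
              ENNReal.ofReal (C₀ * δ ^ 2 * s)) ∧
          (∀ t ∈ Set.Ioo (T - ρ ^ 2) T, ∀ x ∈ Metric.ball x₀ ρ, |α t x| ≤ M ∧
            inner ℝ (Literature.Analysis.FluidPDE.curl (u t) x) (gradient (α t) x) = 0 ∧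
            (0 < d t x → ‖Literature.Analysis.FluidPDE.curl (u t) x‖ * d t x ≤ C₀ * ‖gradient (α t) x‖ ∧
              ‖b t x‖ * d t x ≤ C₀ ∧
              deriv (fun s => α s x) t + Literature.Analysis.FluidPDE.convect (u t) (α t) x =
                ν * (Laplacian.laplacian (α t) x + inner ℝ (b t x) (gradient (α t) x))))) →
        (∃ ρ₂ : ℝ, 0 < ρ₂ ∧ ρ₂ ≤ ρ ∧
          (∀ ε : ℝ, 0 < ε → ∃ η : ℝ, 0 < η ∧
            ∀ t ∈ Set.Ioo (T - ρ₂ ^ 2) T, ∀ s ∈ Set.Ioo (T - ρ₂ ^ 2) T,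
              ∀ x ∈ Metric.ball x₀ ρ₂, ∀ y ∈ Metric.ball x₀ ρ₂,
              |t - s| ≤ η → dist x y ≤ η → |α t x - α s y| ≤ ε)) →
        ∃ r : ℝ, 0 < r ∧ ∃ K : ℝ, ∀ t ∈ Set.Ioo (T - r ^ 2) T, 0 ≤ t →
          ∀ x ∈ Metric.ball x₀ r, ‖u t x‖ ≤ K := by
  intro ν T hν hT u p hcl hLH hdec x₀ ρ C₀ M α b d _hG _hUC
  exact bounded_near_of_hasSmoothExtensionPast (hNB ν T hν hT u p hcl hLH hdec) x₀

/-- **The crux implies stub S1 (`stub_axislikeGaugeAtSingularity`).** Assume `CriticalSwirlRegularity`. The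
gauge hypothesis of S1 IS the crux's gauge hypothesis (the typed v0 block with the thinness clause at scale
`ρ`), so the crux makes `u` bounded near `(T, x₀)` and the extra hypothesis of S1 ("`u` unbounded there") is
contradictory: S1 holds vacuously. (Prose claim "S1 is a corollary of the crux" of the dossier
`Lines/registered-dead.md`, checked.) [folklore] -/
theorem stub_axislikeGaugeAtSingularity_of_criticalSwirlRegularity
    (hCSR : Summit.NavierStokesRegularity.NavierStokesRegularity.Theses.FlatSwirlGauge.CriticalSwirlRegularity) :
    ∀ (ν T : ℝ), 0 < ν → 0 < T →
      ∀ (u : ℝ → EuclideanSpace ℝ (Fin 3) → EuclideanSpace ℝ (Fin 3)) (p : ℝ → EuclideanSpace ℝ (Fin 3) → ℝ),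
        Literature.Analysis.FluidPDE.IsClassicalNSSolutionOn (Set.Ico 0 T) ν 0 u p →
        Literature.Analysis.FluidPDE.IsLerayHopfOn T ν 0 (u 0) u →
        Literature.Analysis.FluidPDE.HasRapidSpatialDecay (u 0) →
      ∀ (x₀ : EuclideanSpace ℝ (Fin 3)) (ρ C₀ M : ℝ) (α : ℝ → EuclideanSpace ℝ (Fin 3) → ℝ)
        (b : ℝ → EuclideanSpace ℝ (Fin 3) → EuclideanSpace ℝ (Fin 3)) (d : ℝ → EuclideanSpace ℝ (Fin 3) → ℝ),
        (0 < ρ ∧ ρ ^ 2 < T ∧ ContDiffOn ℝ 2 (Function.uncurry α) (Set.Ioo (T - ρ ^ 2) T ×ˢ Metric.ball x₀ ρ) ∧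
          (∀ t ∈ Set.Ioo (T - ρ ^ 2) T, ∀ δ ∈ Set.Ioo 0 ρ,
            MeasureTheory.volume ({x | d t x < δ} ∩ Metric.ball x₀ ρ) ≤ ENNReal.ofReal (C₀ * δ ^ 2 * ρ)) ∧
          (∀ t ∈ Set.Ioo (T - ρ ^ 2) T, ∀ x ∈ Metric.ball x₀ ρ, |α t x| ≤ M ∧
            inner ℝ (Literature.Analysis.FluidPDE.curl (u t) x) (gradient (α t) x) = 0 ∧
            (0 < d t x → ‖Literature.Analysis.FluidPDE.curl (u t) x‖ * d t x ≤ C₀ * ‖gradient (α t) x‖ ∧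
              ‖b t x‖ * d t x ≤ C₀ ∧
              deriv (fun s => α s x) t + Literature.Analysis.FluidPDE.convect (u t) (α t) x =
                ν * (Laplacian.laplacian (α t) x + inner ℝ (b t x) (gradient (α t) x))))) →
        ¬ (∃ r : ℝ, 0 < r ∧ ∃ K : ℝ, ∀ t ∈ Set.Ioo (T - r ^ 2) T, 0 ≤ t →
            ∀ x ∈ Metric.ball x₀ r, ‖u t x‖ ≤ K) →
        ∃ (ρ₁ C₁ M₁ : ℝ) (b₁ : ℝ → EuclideanSpace ℝ (Fin 3) → EuclideanSpace ℝ (Fin 3))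
          (d₁ : ℝ → EuclideanSpace ℝ (Fin 3) → ℝ),
          0 < ρ₁ ∧ ρ₁ ^ 2 < T ∧
          ContDiffOn ℝ 2 (Function.uncurry α) (Set.Ioo (T - ρ₁ ^ 2) T ×ˢ Metric.ball x₀ ρ₁) ∧
          (∀ t ∈ Set.Ioo (T - ρ₁ ^ 2) T, ∀ (y : EuclideanSpace ℝ (Fin 3)) (s : ℝ), 0 < s →
            Metric.ball y s ⊆ Metric.ball x₀ ρ₁ →
            ∀ δ ∈ Set.Ioo 0 s, MeasureTheory.volume ({x | d₁ t x < δ} ∩ Metric.ball y s) ≤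
              ENNReal.ofReal (C₁ * δ ^ 2 * s)) ∧
          (∀ t ∈ Set.Ioo (T - ρ₁ ^ 2) T, ∀ x ∈ Metric.ball x₀ ρ₁, |α t x| ≤ M₁ ∧
            inner ℝ (Literature.Analysis.FluidPDE.curl (u t) x) (gradient (α t) x) = 0 ∧
            (0 < d₁ t x → ‖Literature.Analysis.FluidPDE.curl (u t) x‖ * d₁ t x ≤ C₁ * ‖gradient (α t) x‖ ∧
              ‖b₁ t x‖ * d₁ t x ≤ C₁ ∧
              deriv (fun s => α s x) t + Literature.Analysis.FluidPDE.convect (u t) (α t) x =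
                ν * (Laplacian.laplacian (α t) x + inner ℝ (b₁ t x) (gradient (α t) x)))) := by
  intro ν T hν hT u p hcl hLH hdec x₀ ρ C₀ M α b d hG hunb
  exact absurd (hCSR ν T hν hT u p hcl hLH hdec x₀ ⟨ρ, C₀, M, α, b, d, hG⟩) hunb

/-- **The crux implies stub S3 (`stub_continuousMomentumRegularity`).** Assume `CriticalSwirlRegularity`.
The gauge block of S3 differs from the crux's only in its thinness clause, which is LOCAL (all sub-balls
`B_s(y) ⊆ B_ρ(x₀)`); specialised to `y = x₀`, `s = ρ` it gives the typed clause, so the crux applies and yields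
the conclusion of S3 — the modulus hypothesis is not used. (Prose claim "S3 is a corollary of the crux" of
`Lines/registered-dead.md`, checked.) [folklore] -/
theorem stub_continuousMomentumRegularity_of_criticalSwirlRegularity
    (hCSR : Summit.NavierStokesRegularity.NavierStokesRegularity.Theses.FlatSwirlGauge.CriticalSwirlRegularity) :
    ∀ (ν T : ℝ), 0 < ν → 0 < T →
      ∀ (u : ℝ → EuclideanSpace ℝ (Fin 3) → EuclideanSpace ℝ (Fin 3)) (p : ℝ → EuclideanSpace ℝ (Fin 3) → ℝ),
        Literature.Analysis.FluidPDE.IsClassicalNSSolutionOn (Set.Ico 0 T) ν 0 u p →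
        Literature.Analysis.FluidPDE.IsLerayHopfOn T ν 0 (u 0) u →
        Literature.Analysis.FluidPDE.HasRapidSpatialDecay (u 0) →
      ∀ (x₀ : EuclideanSpace ℝ (Fin 3)) (ρ C₀ M : ℝ) (α : ℝ → EuclideanSpace ℝ (Fin 3) → ℝ)
        (b : ℝ → EuclideanSpace ℝ (Fin 3) → EuclideanSpace ℝ (Fin 3)) (d : ℝ → EuclideanSpace ℝ (Fin 3) → ℝ),
        (0 < ρ ∧ ρ ^ 2 < T ∧ ContDiffOn ℝ 2 (Function.uncurry α) (Set.Ioo (T - ρ ^ 2) T ×ˢ Metric.ball x₀ ρ) ∧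
          (∀ t ∈ Set.Ioo (T - ρ ^ 2) T, ∀ (y : EuclideanSpace ℝ (Fin 3)) (s : ℝ), 0 < s →
            Metric.ball y s ⊆ Metric.ball x₀ ρ →
            ∀ δ ∈ Set.Ioo 0 s, MeasureTheory.volume ({x | d t x < δ} ∩ Metric.ball y s) ≤
              ENNReal.ofReal (C₀ * δ ^ 2 * s)) ∧
          (∀ t ∈ Set.Ioo (T - ρ ^ 2) T, ∀ x ∈ Metric.ball x₀ ρ, |α t x| ≤ M ∧
            inner ℝ (Literature.Analysis.FluidPDE.curl (u t) x) (gradient (α t) x) = 0 ∧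
            (0 < d t x → ‖Literature.Analysis.FluidPDE.curl (u t) x‖ * d t x ≤ C₀ * ‖gradient (α t) x‖ ∧
              ‖b t x‖ * d t x ≤ C₀ ∧
              deriv (fun s => α s x) t + Literature.Analysis.FluidPDE.convect (u t) (α t) x =
                ν * (Laplacian.laplacian (α t) x + inner ℝ (b t x) (gradient (α t) x))))) →
        (∃ ρ₂ : ℝ, 0 < ρ₂ ∧ ρ₂ ≤ ρ ∧
          (∀ ε : ℝ, 0 < ε → ∃ η : ℝ, 0 < η ∧
            ∀ t ∈ Set.Ioo (T - ρ₂ ^ 2) T, ∀ s ∈ Set.Ioo (T - ρ₂ ^ 2) T,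
              ∀ x ∈ Metric.ball x₀ ρ₂, ∀ y ∈ Metric.ball x₀ ρ₂,
              |t - s| ≤ η → dist x y ≤ η → |α t x - α s y| ≤ ε)) →
        ∃ r : ℝ, 0 < r ∧ ∃ K : ℝ, ∀ t ∈ Set.Ioo (T - r ^ 2) T, 0 ≤ t →
          ∀ x ∈ Metric.ball x₀ r, ‖u t x‖ ≤ K := by
  intro ν T hν hT u p hcl hLH hdec x₀ ρ C₀ M α b d hG _hUC
  obtain ⟨hρ, hρT, hC2, hthin, hpt⟩ := hG
  exact hCSR ν T hν hT u p hcl hLH hdec x₀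
    ⟨ρ, C₀, M, α, b, d, hρ, hρT, hC2,
      fun t ht δ hδ => hthin t ht x₀ ρ hρ subset_rfl δ hδ, hpt⟩

/-- **Hardness of stub S3: it contains localized axisymmetric regularity under a bare uniform modulus of the
swirl.** Assume the registered signature of S3 (`stub_continuousMomentumRegularity`). Let `(u, p)` be a
classical Navier–Stokes solution on `ℝ³ × [0, T)` (`ν > 0`, no force), Leray–Hopf from a rapidly decaying
datum, with axisymmetric velocity and pressure, and let `Q_ρ(T, x₀)` (`0 < ρ`, `ρ² < T`) be a backward
cylinder on which the swirl `Γ = swirl (u t) = r u_θ` satisfies `|Γ| ≤ M`, the swirl-dominance bound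
`‖curl u‖ r ≤ C ‖∇Γ‖`, and is UNIFORMLY CONTINUOUS in `(t, x)` (any modulus, typed `∀ ε ∃ η` exactly as in S3).
Then `u` is bounded on some `(T − r², T) × B_r(x₀)`. Proof: the exactly-flat anchor
`IsClassicalNSSolutionOn.isFlatSwirlGaugeOn_swirl` (KNSS 2009, eq. (1.8): `α = Γ`, `b = −(2/r)e_r`, `d = r`,
constant `max C 8`) supplies every clause of the gauge block of S3 except local thinness, which is the tube
estimate `vol({r < δ} ∩ B_s(y)) ≤ 8 δ² s` (`volume_cylRadius_lt_inter_ball_le`) on each sub-ball. Print proves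
such regularity only under a RATE at the axis (Lei–Zhang 2017 Cor. 1.3 `C₁|ln r|⁻²`; Wei 2016 Cor. 1.1
`|ln r|^{-3/2}`; Lei–Zhang 2017 Thm. 1.4, smallness below an `r₀`-dependent threshold) and globally along the
axis; for a bare modulus, and localized, it is open — so S3 is beyond print on its own.
[cite: KNSS2009, eq. (1.8)] -/
theorem bounded_of_stub_continuousMomentumRegularity_of_axisymmetric
    (hS3 : ∀ (ν T : ℝ), 0 < ν → 0 < T →
      ∀ (u : ℝ → EuclideanSpace ℝ (Fin 3) → EuclideanSpace ℝ (Fin 3)) (p : ℝ → EuclideanSpace ℝ (Fin 3) → ℝ),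
        Literature.Analysis.FluidPDE.IsClassicalNSSolutionOn (Set.Ico 0 T) ν 0 u p →
        Literature.Analysis.FluidPDE.IsLerayHopfOn T ν 0 (u 0) u →
        Literature.Analysis.FluidPDE.HasRapidSpatialDecay (u 0) →
      ∀ (x₀ : EuclideanSpace ℝ (Fin 3)) (ρ C₀ M : ℝ) (α : ℝ → EuclideanSpace ℝ (Fin 3) → ℝ)
        (b : ℝ → EuclideanSpace ℝ (Fin 3) → EuclideanSpace ℝ (Fin 3)) (d : ℝ → EuclideanSpace ℝ (Fin 3) → ℝ),
        (0 < ρ ∧ ρ ^ 2 < T ∧ ContDiffOn ℝ 2 (Function.uncurry α) (Set.Ioo (T - ρ ^ 2) T ×ˢ Metric.ball x₀ ρ) ∧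
          (∀ t ∈ Set.Ioo (T - ρ ^ 2) T, ∀ (y : EuclideanSpace ℝ (Fin 3)) (s : ℝ), 0 < s →
            Metric.ball y s ⊆ Metric.ball x₀ ρ →
            ∀ δ ∈ Set.Ioo 0 s, MeasureTheory.volume ({x | d t x < δ} ∩ Metric.ball y s) ≤
              ENNReal.ofReal (C₀ * δ ^ 2 * s)) ∧
          (∀ t ∈ Set.Ioo (T - ρ ^ 2) T, ∀ x ∈ Metric.ball x₀ ρ, |α t x| ≤ M ∧
            inner ℝ (Literature.Analysis.FluidPDE.curl (u t) x) (gradient (α t) x) = 0 ∧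
            (0 < d t x → ‖Literature.Analysis.FluidPDE.curl (u t) x‖ * d t x ≤ C₀ * ‖gradient (α t) x‖ ∧
              ‖b t x‖ * d t x ≤ C₀ ∧
              deriv (fun s => α s x) t + Literature.Analysis.FluidPDE.convect (u t) (α t) x =
                ν * (Laplacian.laplacian (α t) x + inner ℝ (b t x) (gradient (α t) x))))) →
        (∃ ρ₂ : ℝ, 0 < ρ₂ ∧ ρ₂ ≤ ρ ∧
          (∀ ε : ℝ, 0 < ε → ∃ η : ℝ, 0 < η ∧
            ∀ t ∈ Set.Ioo (T - ρ₂ ^ 2) T, ∀ s ∈ Set.Ioo (T - ρ₂ ^ 2) T,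
              ∀ x ∈ Metric.ball x₀ ρ₂, ∀ y ∈ Metric.ball x₀ ρ₂,
              |t - s| ≤ η → dist x y ≤ η → |α t x - α s y| ≤ ε)) →
        ∃ r : ℝ, 0 < r ∧ ∃ K : ℝ, ∀ t ∈ Set.Ioo (T - r ^ 2) T, 0 ≤ t →
          ∀ x ∈ Metric.ball x₀ r, ‖u t x‖ ≤ K)
    {ν T : ℝ} (hν : 0 < ν) (hT : 0 < T)
    {u : ℝ → EuclideanSpace ℝ (Fin 3) → EuclideanSpace ℝ (Fin 3)} {p : ℝ → EuclideanSpace ℝ (Fin 3) → ℝ}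
    (h : IsClassicalNSSolutionOn (Set.Ico 0 T) ν 0 u p) (hLH : IsLerayHopfOn T ν 0 (u 0) u)
    (hdec : HasRapidSpatialDecay (u 0))
    (hu : ∀ t ∈ Set.Ico 0 T, IsAxisymmetric (u t)) (hp : ∀ t ∈ Set.Ico 0 T, IsAxisymmetricScalar (p t))
    {x₀ : EuclideanSpace ℝ (Fin 3)} {ρ C M : ℝ} (hρ : 0 < ρ) (hρT : ρ ^ 2 < T)
    (hM : ∀ t ∈ Set.Ioo (T - ρ ^ 2) T, ∀ x ∈ Metric.ball x₀ ρ, |swirl (u t) x| ≤ M)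
    (hω : ∀ t ∈ Set.Ioo (T - ρ ^ 2) T, ∀ x ∈ Metric.ball x₀ ρ,
      ‖curl (u t) x‖ * cylRadius x ≤ C * ‖gradient (swirl (u t)) x‖)
    (hUC : ∀ ε : ℝ, 0 < ε → ∃ η : ℝ, 0 < η ∧
      ∀ t ∈ Set.Ioo (T - ρ ^ 2) T, ∀ s ∈ Set.Ioo (T - ρ ^ 2) T,
        ∀ x ∈ Metric.ball x₀ ρ, ∀ y ∈ Metric.ball x₀ ρ,
        |t - s| ≤ η → dist x y ≤ η → |swirl (u t) x - swirl (u s) y| ≤ ε) :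
    ∃ r : ℝ, 0 < r ∧ ∃ K : ℝ, ∀ t ∈ Set.Ioo (T - r ^ 2) T, 0 ≤ t →
      ∀ x ∈ Metric.ball x₀ r, ‖u t x‖ ≤ K := by
  -- the exactly-flat anchor with constant `max C 8`
  have hω' : ∀ t ∈ Set.Ioo (T - ρ ^ 2) T, ∀ x ∈ Metric.ball x₀ ρ,
      ‖curl (u t) x‖ * cylRadius x ≤ max C 8 * ‖gradient (swirl (u t)) x‖ := fun t ht x hx =>
    (hω t ht x hx).trans (mul_le_mul_of_nonneg_right (le_max_left C 8) (norm_nonneg _))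
  have hG := h.isFlatSwirlGaugeOn_swirl hu hp hρ hρT (le_max_right C 8) hM hω'
  obtain ⟨-, -, hC2, -, hpt⟩ := hG
  refine hS3 ν T hν hT u p h hLH hdec x₀ ρ (max C 8) M (fun t => swirl (u t))
    (fun _ x => (-(2 / cylRadius x)) • eR x) (fun _ => cylRadius) ⟨hρ, hρT, hC2, ?_, hpt⟩
    ⟨ρ, hρ, le_rfl, hUC⟩
  -- local thinness of the tube around the axis on every sub-ball
  intro t _ y s _ _ δ hδ
  refine (volume_cylRadius_lt_inter_ball_le y s hδ.1.le).trans (ENNReal.ofReal_le_ofReal ?_)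
  have h8 : (8 : ℝ) ≤ max C 8 := le_max_right C 8
  have : 0 ≤ δ ^ 2 * s := by
    have := hδ.2.le
    have hδ0 := hδ.1.le
    positivity
  nlinarith

end Summit.NavierStokesRegularity.NavierStokesRegularity.Theorems.CriticalSwirlRegularity.Negative
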